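import Literature.InformationTheory.Entropy.RelativeEntropyMonotonicity
import Literature.MathematicalPhysics.QuantumLattice.KroneckerPartialTrace
import Mathlib.Analysis.CStarAlgebra.ContinuousFunctionalCalculus.Continuity
import Mathlib.Analysis.CStarAlgebra.Matrix
import Mathlib.Analysis.SpecialFunctions.Log.NegMulLog
import HarnessLib

/-!
# Monotonicity of the quantum relative entropy under partial traces — both factors and all
# density matrices (Petz's approximation argument)

Topic `InformationTheory/Entropy`, namespace `Literature.InformationTheory.Entropy`.

The positive definite case over the first factor is
`Literature.InformationTheory.Entropy.re_trace_traceLeft_mul_log_sub_log_le`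
(`RelativeEntropyMonotonicity.lean`).  Here:

* the SECOND factor: `Re Tr (Tr_B ρ (log Tr_B ρ − log Tr_B σ)) ≤ Re Tr (ρ (log ρ − log σ))`
  (`traceRight`; Lindblad's Lemma 2 as printed, "`A₁ = Tr₂ A`" [cite: Lindblad1975, Lemma 2 p.149]),
  by the swap `ℋ_A ⊗ ℋ_B ≃ ℋ_B ⊗ ℋ_A` (reindexing invariance of matrix functions and traces);
* SINGULAR `ρ`: for a density matrix `ρ` (positive semidefinite, trace one) and a positive definite
  density matrix `σ`, both inequalities follow from the positive definite case at
  `ρ_ε = (1 − ε) ρ + ε σ` by letting `ε → 0⁺` — "The general case can be covered by an approximation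
  argument" [cite: Petz2008, proof of Theorem 3.10] — using the continuity of the matrix functional
  calculus in the matrix (Mathlib's `Filter.Tendsto.cfc`, on density matrices, whose spectra lie in
  `[0, 1]`).

The named fact `relEntropy_partialTrace_le` of `VonNeumannEntropyInequalities.lean`
[cite: Lindblad1975, Lemma 2 p.149] [cite: NielsenChuang2010, Theorem 11.17 eq. (11.125) p.524]
is exactly the conjunction of `re_trace_traceLeft_mul_log_sub_log_le_of_density` and
`re_trace_traceRight_mul_log_sub_log_le_of_density` below (it is discharged there).

## References

* G. Lindblad, *Completely positive maps and entropy inequalities*, Commun. Math. Phys. 40 (1975)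
  147–151, Lemma 2. [Lindblad1975]
* D. Petz, *Quantum Information Theory and Quantum Statistics* (Springer 2008), Theorems 3.9,
  3.10 and their proof. [Petz2008]
* M. A. Nielsen, I. L. Chuang, *Quantum Computation and Quantum Information* (CUP 2010),
  §2.4.3, Theorem 11.17. [NielsenChuang2010]
-/

noncomputable section

open Matrix Filter Topology
open scoped MatrixOrder ComplexOrder Kronecker

namespace Literature.InformationTheory.Entropy

open Literature.Computability.QuantumComplexity (traceLeft traceRight traceLeft_apply
  traceRight_apply)
open Literature.LinearAlgebra.Matrix

variable {m n : Type*} [Fintype m] [Fintype n] [DecidableEq m] [DecidableEq n]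

/-! ### The second factor, by swapping the two factors -/

omit [Fintype m] [DecidableEq m] [DecidableEq n] in
/-- `Tr_B ρ = Tr_A (swap ρ swap)`: the partial trace over the second factor is the partial trace over
the first factor of the reindexed matrix. [cite: NielsenChuang2010, §2.4.3 eq. (2.178)] -/
theorem traceLeft_submatrix_swap (ρ : Matrix (m × n) (m × n) ℂ) :
    traceLeft (ρ.submatrix Prod.swap Prod.swap : Matrix (n × m) (n × m) ℂ) = traceRight ρ := by
  ext a a'
  simp [traceLeft_apply, traceRight_apply]

omit [DecidableEq m] in
/-- The trace is invariant under reindexing by a bijection. [folklore] -/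
private theorem trace_submatrix_equiv {p : Type*} [Fintype p] (A : Matrix m m ℂ) (e : p ≃ m) :
    (A.submatrix e e).trace = A.trace := by
  simp only [Matrix.trace, Matrix.diag, Matrix.submatrix_apply]
  exact e.sum_comp (fun i => A i i)

/-- The relative-entropy functional `Tr (A (log A − log B))` is invariant under a simultaneous
reindexing of `A` and `B` by a bijection. [cite: NielsenChuang2010, §11.3.1 eq. (11.50)] -/
theorem trace_submatrix_mul_log_sub_log {p : Type*} [Fintype p] [DecidableEq p]
    {A B : Matrix m m ℂ} (hA : A.IsHermitian) (hB : B.IsHermitian) (e : p ≃ m) :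
    (A.submatrix e e * (cfc Real.log (A.submatrix e e) - cfc Real.log (B.submatrix e e))).trace =
      (A * (cfc Real.log A - cfc Real.log B)).trace := by
  rw [cfc_submatrix_equiv hA e, cfc_submatrix_equiv hB e]
  have hsub : (cfc Real.log A).submatrix e e - (cfc Real.log B).submatrix e e =
      (cfc Real.log A - cfc Real.log B).submatrix e e := rfl
  rw [hsub, Matrix.submatrix_mul_equiv, trace_submatrix_equiv]

/-- **Monotonicity under the partial trace over the SECOND factor, positive definite case**:
`Re Tr (Tr_B ρ (log Tr_B ρ − log Tr_B σ)) ≤ Re Tr (ρ (log ρ − log σ))` for positive definite `ρ, σ`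
(Lindblad's `S(A₁|B₁) ≤ S(A|B)`, `A₁ = Tr₂ A`). [cite: Lindblad1975, Lemma 2 p.149]
[cite: Petz2008, Theorem 3.9] -/
theorem re_trace_traceRight_mul_log_sub_log_le {ρ σ : Matrix (m × n) (m × n) ℂ}
    (hρ : ρ.PosDef) (hσ : σ.PosDef) :
    ((traceRight ρ * (cfc Real.log (traceRight ρ) - cfc Real.log (traceRight σ))).trace).re ≤
      ((ρ * (cfc Real.log ρ - cfc Real.log σ)).trace).re := by
  have e : n × m ≃ m × n := Equiv.prodComm n m
  have hρ' : (ρ.submatrix Prod.swap Prod.swap : Matrix (n × m) (n × m) ℂ).PosDef :=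
    hρ.submatrix (Equiv.prodComm n m).injective
  have hσ' : (σ.submatrix Prod.swap Prod.swap : Matrix (n × m) (n × m) ℂ).PosDef :=
    hσ.submatrix (Equiv.prodComm n m).injective
  have h := re_trace_traceLeft_mul_log_sub_log_le hρ' hσ'
  rw [traceLeft_submatrix_swap, traceLeft_submatrix_swap] at h
  have hsw : (ρ.submatrix Prod.swap Prod.swap *
      (cfc Real.log (ρ.submatrix Prod.swap Prod.swap) - cfc Real.log (σ.submatrix Prod.swap Prod.swap)) :
        Matrix (n × m) (n × m) ℂ).trace = (ρ * (cfc Real.log ρ - cfc Real.log σ)).trace :=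
    trace_submatrix_mul_log_sub_log hρ.isHermitian hσ.isHermitian (Equiv.prodComm n m)
  rwa [hsw] at h

/-! ### Density matrices: spectra in `[0, 1]`, continuity of matrix functions along densities -/

section Density

variable {d : Type*} [Fintype d] [DecidableEq d]

/-- The spectrum of a density matrix (positive semidefinite, trace one) lies in `[0, 1]`.
[cite: NielsenChuang2010, §2.4.2 (Theorem 2.5)] -/
theorem spectrum_subset_Icc_of_posSemidef_of_trace_eq_one {ρ : Matrix d d ℂ} (hρ : ρ.PosSemidef)
    (htr : ρ.trace = 1) : spectrum ℝ ρ ⊆ Set.Icc 0 1 := by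
  intro x hx
  rw [hρ.1.spectrum_real_eq_range_eigenvalues] at hx
  obtain ⟨i, rfl⟩ := hx
  refine ⟨hρ.eigenvalues_nonneg i, ?_⟩
  have hsum : ∑ j, hρ.1.eigenvalues j = 1 := by
    have h := congrArg Complex.re hρ.1.trace_eq_sum_eigenvalues
    rw [htr] at h
    simpa using h.symm
  calc hρ.1.eigenvalues i ≤ ∑ j, hρ.1.eigenvalues j :=
        Finset.single_le_sum (fun j _ => hρ.eigenvalues_nonneg j) (Finset.mem_univ i)
    _ = 1 := hsum

/-- **Continuity of matrix functions along density matrices**: if `a x → a₀` with `a x` and `a₀`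
density matrices and `f` is continuous on `[0, 1]`, then `f(a x) → f(a₀)` (Mathlib's
`Filter.Tendsto.cfc` for the isometric functional calculus of `Matrix d d ℂ` with the
`L²`-operator norm, opened inside the proof). [cite: Petz2008, proof of Theorem 3.10
("approximation argument")] -/
theorem tendsto_cfc_of_density {X : Type*} {l : Filter X} {a : X → Matrix d d ℂ} {a₀ : Matrix d d ℂ}
    (f : ℝ → ℝ) (hf : ContinuousOn f (Set.Icc 0 1)) (ha : Tendsto a l (𝓝 a₀))
    (hdens : ∀ᶠ x in l, (a x).PosSemidef ∧ (a x).trace = 1) (h₀ : a₀.PosSemidef) (h₀tr : a₀.trace = 1) :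
    Tendsto (fun x => cfc f (a x)) l (𝓝 (cfc f a₀)) := by
  open scoped Matrix.Norms.L2Operator in
  exact by
    refine ha.cfc isCompact_Icc f ?_ ?_ (spectrum_subset_Icc_of_posSemidef_of_trace_eq_one h₀ h₀tr)
      h₀.1.isSelfAdjoint hf
    · filter_upwards [hdens] with x hx
      exact spectrum_subset_Icc_of_posSemidef_of_trace_eq_one hx.1 hx.2
    · filter_upwards [hdens] with x hx
      exact hx.1.1.isSelfAdjoint

omit [DecidableEq d] in
/-- `x ↦ Re Tr (A x)` inherits limits from `A`. [folklore] -/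
private theorem tendsto_re_trace {X : Type*} {l : Filter X} {A : X → Matrix d d ℂ} {A₀ : Matrix d d ℂ}
    (h : Tendsto A l (𝓝 A₀)) : Tendsto (fun x => ((A x).trace).re) l (𝓝 (A₀.trace).re) :=
  ((Complex.continuous_re.comp (continuous_id.matrix_trace)).tendsto A₀).comp h

/-- `ρ log ρ = (t ↦ t log t)(ρ)` for a Hermitian matrix. [cite: NielsenChuang2010, §11.3 eq. (11.40)] -/
theorem mul_cfc_log_eq_cfc_mul_log {ρ : Matrix d d ℂ} (hρ : ρ.IsHermitian) :
    ρ * cfc Real.log ρ = cfc (fun t => t * Real.log t) ρ := by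
  have hρ' : IsSelfAdjoint ρ := hρ
  rw [cfc_mul (fun t : ℝ => t) Real.log ρ (cfc_continuousOn ρ _) (cfc_continuousOn ρ _), cfc_id' ℝ ρ]

end Density

/-! ### The affine path `ρ_ε = (1 − ε) ρ + ε σ` -/

section Path

variable {d : Type*} [Fintype d] [DecidableEq d]

omit [Fintype d] [DecidableEq d] in
/-- `ε ↦ (1 − ε) ρ + ε σ` is continuous. [folklore] -/
private theorem continuous_path (ρ σ : Matrix d d ℂ) :
    Continuous fun ε : ℝ => (((1 - ε : ℝ) : ℂ)) • ρ + ((ε : ℝ) : ℂ) • σ :=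
  ((Complex.continuous_ofReal.comp (continuous_const.sub continuous_id)).smul continuous_const).add
    ((Complex.continuous_ofReal.comp continuous_id).smul continuous_const)

omit [Fintype d] [DecidableEq d] in
/-- Along `ε → 0⁺`, `(1 − ε) ρ + ε σ → ρ`. [folklore] -/
private theorem tendsto_path (ρ σ : Matrix d d ℂ) :
    Tendsto (fun ε : ℝ => (((1 - ε : ℝ) : ℂ)) • ρ + ((ε : ℝ) : ℂ) • σ) (𝓝[>] 0) (𝓝 ρ) := by
  have h := ((continuous_path ρ σ).tendsto 0).mono_left (nhdsWithin_le_nhds (s := Set.Ioi (0:ℝ)))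
  simpa using h

omit [Fintype d] [DecidableEq d] in
/-- For `ε ∈ (0, 1]`, `(1 − ε) ρ + ε σ` is a positive definite density when `ρ` is a density and
`σ` a positive definite density. [cite: Petz2008, proof of Theorem 3.10] -/
private theorem posDef_path {ρ σ : Matrix d d ℂ} (hρ : ρ.PosSemidef) (hσ : σ.PosDef) {ε : ℝ}
    (h0 : 0 < ε) (h1 : ε ≤ 1) :
    ((((1 - ε : ℝ) : ℂ)) • ρ + ((ε : ℝ) : ℂ) • σ).PosDef :=
  Matrix.PosDef.posSemidef_add (hρ.smul (Complex.zero_le_real.mpr (by linarith)))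
    (hσ.smul (Complex.zero_lt_real.mpr h0))

omit [DecidableEq d] in
/-- The affine path stays of trace one. [folklore] -/
private theorem trace_path {ρ σ : Matrix d d ℂ} (hρ : ρ.trace = 1) (hσ : σ.trace = 1) (ε : ℝ) :
    ((((1 - ε : ℝ) : ℂ)) • ρ + ((ε : ℝ) : ℂ) • σ).trace = 1 := by
  rw [Matrix.trace_add, Matrix.trace_smul, Matrix.trace_smul, hρ, hσ, smul_eq_mul, smul_eq_mul,
    mul_one, mul_one, ← Complex.ofReal_add, sub_add_cancel, Complex.ofReal_one]

/-- Along the path, `Re Tr (ρ_ε (log ρ_ε − log σ)) → Re Tr (ρ (log ρ − log σ))` as `ε → 0⁺`.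
[cite: Petz2008, proof of Theorem 3.10 ("approximation argument")] -/
private theorem tendsto_re_trace_path_mul_log_sub_log {ρ σ : Matrix d d ℂ} (hρ : ρ.PosSemidef)
    (hρtr : ρ.trace = 1) (hσ : σ.PosDef) (hσtr : σ.trace = 1) :
    Tendsto (fun ε : ℝ => (((((1 - ε : ℝ) : ℂ)) • ρ + ((ε : ℝ) : ℂ) • σ) *
        (cfc Real.log ((((1 - ε : ℝ) : ℂ)) • ρ + ((ε : ℝ) : ℂ) • σ) - cfc Real.log σ)).trace.re)
      (𝓝[>] 0) (𝓝 ((ρ * (cfc Real.log ρ - cfc Real.log σ)).trace).re) := by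
  have hdens : ∀ᶠ ε in 𝓝[>] (0 : ℝ),
      ((((1 - ε : ℝ) : ℂ)) • ρ + ((ε : ℝ) : ℂ) • σ).PosSemidef ∧
        ((((1 - ε : ℝ) : ℂ)) • ρ + ((ε : ℝ) : ℂ) • σ).trace = 1 := by
    filter_upwards [Ioo_mem_nhdsGT (zero_lt_one' ℝ)] with ε hε
    exact ⟨(posDef_path hρ hσ hε.1 hε.2.le).posSemidef, trace_path hρtr hσtr ε⟩
  have hcfc := tendsto_cfc_of_density (fun t => t * Real.log t)
    (Real.continuous_mul_log.continuousOn) (tendsto_path ρ σ) hdens hρ hρtr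
  have h1 := tendsto_re_trace hcfc
  have h2 := tendsto_re_trace ((tendsto_path ρ σ).mul
    (tendsto_const_nhds (x := cfc Real.log σ)))
  have key : ∀ (A : Matrix d d ℂ), A.IsHermitian →
      ((A * (cfc Real.log A - cfc Real.log σ)).trace).re =
        ((cfc (fun t => t * Real.log t) A).trace).re - ((A * cfc Real.log σ).trace).re := by
    intro A hA
    rw [Matrix.mul_sub, Matrix.trace_sub, Complex.sub_re, mul_cfc_log_eq_cfc_mul_log hA]
  rw [key ρ hρ.1]
  refine ((h1.sub h2).congr' ?_)
  filter_upwards [hdens] with ε hε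
  rw [key _ hε.1.1]

end Path

/-! ### The monotonicity for all density matrices -/

omit [Fintype n] [DecidableEq m] [DecidableEq n] in
/-- `Tr_A` is additive. [folklore] -/
private theorem traceLeft_add (ρ σ : Matrix (m × n) (m × n) ℂ) :
    traceLeft (ρ + σ) = traceLeft ρ + traceLeft σ := by
  ext b b'
  simp [traceLeft_apply, Finset.sum_add_distrib]

omit [Fintype n] [DecidableEq m] [DecidableEq n] in
/-- `Tr_A` is homogeneous. [folklore] -/
private theorem traceLeft_smul (c : ℂ) (ρ : Matrix (m × n) (m × n) ℂ) :
    traceLeft (c • ρ) = c • traceLeft ρ := by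
  ext b b'
  simp [traceLeft_apply, Finset.mul_sum]

omit [Fintype n] [DecidableEq m] [DecidableEq n] in
/-- `Tr_A` along the affine path. [folklore] -/
private theorem traceLeft_path (ρ σ : Matrix (m × n) (m × n) ℂ) (ε : ℝ) :
    traceLeft ((((1 - ε : ℝ) : ℂ)) • ρ + ((ε : ℝ) : ℂ) • σ) =
      (((1 - ε : ℝ) : ℂ)) • traceLeft ρ + ((ε : ℝ) : ℂ) • traceLeft σ := by
  rw [traceLeft_add, traceLeft_smul, traceLeft_smul]

omit [DecidableEq m] [DecidableEq n] in
/-- A matrix on `m × n` with trace one has `m` nonempty. [folklore] -/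
private theorem nonempty_of_trace_eq_one {ρ : Matrix (m × n) (m × n) ℂ} (h : ρ.trace = 1) :
    Nonempty m := by
  by_contra hm
  rw [not_nonempty_iff] at hm
  rw [Matrix.trace_eq_zero_of_isEmpty] at h
  exact zero_ne_one h

/-- **Monotonicity of the quantum relative entropy under the partial trace over the first
factor**, for every density matrix `ρ` and every positive definite density matrix `σ`:
`Re Tr (Tr_A ρ (log Tr_A ρ − log Tr_A σ)) ≤ Re Tr (ρ (log ρ − log σ))` — from the positive definite
case at `ρ_ε = (1 − ε) ρ + ε σ`, `ε → 0⁺`. [cite: Lindblad1975, Lemma 2 p.149]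
[cite: Petz2008, Theorem 3.9 and proof of Theorem 3.10] [cite: NielsenChuang2010, Theorem 11.17] -/
theorem re_trace_traceLeft_mul_log_sub_log_le_of_density {ρ σ : Matrix (m × n) (m × n) ℂ}
    (hρ : ρ.PosSemidef) (hρtr : ρ.trace = 1) (hσ : σ.PosDef) (hσtr : σ.trace = 1) :
    ((traceLeft ρ * (cfc Real.log (traceLeft ρ) - cfc Real.log (traceLeft σ))).trace).re ≤
      ((ρ * (cfc Real.log ρ - cfc Real.log σ)).trace).re := by
  haveI : Nonempty m := nonempty_of_trace_eq_one hρtr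
  -- the right-hand sides converge
  have hG := tendsto_re_trace_path_mul_log_sub_log hρ hρtr hσ hσtr
  -- the left-hand sides converge: the partial traces move along the corresponding path
  have hρB : (traceLeft ρ).PosSemidef :=
    Literature.MathematicalPhysics.QuantumLattice.posSemidef_traceLeft hρ
  have hρBtr : (traceLeft ρ).trace = 1 := by
    rw [Literature.Computability.QuantumComplexity.trace_traceLeft, hρtr]
  have hσB : (traceLeft σ).PosDef := posDef_traceLeft hσ
  have hσBtr : (traceLeft σ).trace = 1 := by
    rw [Literature.Computability.QuantumComplexity.trace_traceLeft, hσtr]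
  have hF := tendsto_re_trace_path_mul_log_sub_log hρB hρBtr hσB hσBtr
  -- the inequality along the path, `ε ∈ (0, 1)`
  refine le_of_tendsto_of_tendsto hF hG ?_
  filter_upwards [Ioo_mem_nhdsGT (zero_lt_one' ℝ)] with ε hε
  have h := re_trace_traceLeft_mul_log_sub_log_le (posDef_path hρ hσ hε.1 hε.2.le)
    (posDef_path hσ.posSemidef hσ hε.1 hε.2.le)
  rw [traceLeft_path, traceLeft_path] at h
  have hσσ : (((1 - ε : ℝ) : ℂ)) • σ + ((ε : ℝ) : ℂ) • σ = σ := by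
    rw [← add_smul, ← Complex.ofReal_add, sub_add_cancel, Complex.ofReal_one, one_smul]
  have hσσB : (((1 - ε : ℝ) : ℂ)) • traceLeft σ + ((ε : ℝ) : ℂ) • traceLeft σ = traceLeft σ := by
    rw [← add_smul, ← Complex.ofReal_add, sub_add_cancel, Complex.ofReal_one, one_smul]
  rw [hσσ, hσσB] at h
  exact h

/-- **Monotonicity of the quantum relative entropy under the partial trace over the second
factor**, for every density matrix `ρ` and every positive definite density matrix `σ`.
[cite: Lindblad1975, Lemma 2 p.149] [cite: NielsenChuang2010, Theorem 11.17 eq. (11.125)] -/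
theorem re_trace_traceRight_mul_log_sub_log_le_of_density {ρ σ : Matrix (m × n) (m × n) ℂ}
    (hρ : ρ.PosSemidef) (hρtr : ρ.trace = 1) (hσ : σ.PosDef) (hσtr : σ.trace = 1) :
    ((traceRight ρ * (cfc Real.log (traceRight ρ) - cfc Real.log (traceRight σ))).trace).re ≤
      ((ρ * (cfc Real.log ρ - cfc Real.log σ)).trace).re := by
  have hρ' : (ρ.submatrix Prod.swap Prod.swap : Matrix (n × m) (n × m) ℂ).PosSemidef :=
    hρ.submatrix Prod.swap
  have hσ' : (σ.submatrix Prod.swap Prod.swap : Matrix (n × m) (n × m) ℂ).PosDef :=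
    hσ.submatrix (Equiv.prodComm n m).injective
  have hρtr' : (ρ.submatrix Prod.swap Prod.swap : Matrix (n × m) (n × m) ℂ).trace = 1 := by
    rw [← hρtr]; exact trace_submatrix_equiv ρ (Equiv.prodComm n m)
  have hσtr' : (σ.submatrix Prod.swap Prod.swap : Matrix (n × m) (n × m) ℂ).trace = 1 := by
    rw [← hσtr]; exact trace_submatrix_equiv σ (Equiv.prodComm n m)
  have h := re_trace_traceLeft_mul_log_sub_log_le_of_density hρ' hρtr' hσ' hσtr'
  rw [traceLeft_submatrix_swap, traceLeft_submatrix_swap] at h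
  have hsw : (ρ.submatrix Prod.swap Prod.swap *
      (cfc Real.log (ρ.submatrix Prod.swap Prod.swap) - cfc Real.log (σ.submatrix Prod.swap Prod.swap)) :
        Matrix (n × m) (n × m) ℂ).trace = (ρ * (cfc Real.log ρ - cfc Real.log σ)).trace :=
    trace_submatrix_mul_log_sub_log hρ.1 hσ.isHermitian (Equiv.prodComm n m)
  rwa [hsw] at h

end Literature.InformationTheory.Entropy
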